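import Literature.Probability.LatticeModels.BinomialEntropy
import Mathlib.Analysis.SpecialFunctions.BinaryEntropy
import Mathlib.Analysis.SpecialFunctions.Log.Deriv
import Mathlib.Analysis.SpecialFunctions.Pow.Real
import Mathlib.Analysis.SpecialFunctions.Sqrt
import Mathlib.Analysis.Calculus.Deriv.MeanValue
import Mathlib.Analysis.Complex.ExponentialBounds
import HarnessLib

/-!
# The minimum of `φ(α) = (log 2 - h(α))(B - αC)` on `[9/10, 1]` (Achlioptas–Peres, end of §9)

AP2004 (D. Achlioptas, Y. Peres, J. Amer. Math. Soc. 17 (2004); arXiv:cs/0305009), pp. 19–21: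
after the chain (57)–(67) the proof of Lemma 9 reduces to minimising
`φ(α) = (log 2 - h(α)) (B - αC)`, `B = 2^k(k+1) - 3k - 1/2`, `C = k(2^k - 7/2)` over
`α ∈ (9/10, 1]`; AP locate the minimiser within `22k² 2^{-2k}` of `1 - 2^{-k}` by a
"bootstrapping" argument ((71)–(82)) and conclude (83): `φ_min > 2^k log 2 + (k-1) log 2/2 - 1
- 46 k³ 2^{-k}`. We prove the same lower bound with the error `10 k²/2^k`, for `k ≥ 1024`, by a
direct argument: with `y = 1 - α` and `v = y 2^k`,
`φ ≥ (log 2 + y log y - y)(2^k + (k-1)/2 + yk(2^k - 7/2)) = 2^k log 2 + (k-1) log 2/2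
+ (v log v - v) - R` with an explicit remainder `R`, and `v log v - v ≥ -1`; the remainder is
`O(k²/2^k)` for `v ≤ 2` and is dominated by `v log v - v + 1` for `v ≥ 2` (two regimes), while
for `y ≥ 4/k` the factor `B - αC ≥ 5 · 2^k - 14` makes the bound trivial.

## Results (all proved; `spinRate (2α - 1) = log 2 - h(α)`,
`Literature.Probability.LatticeModels.spinRate`)

* `spinRate_two_mul_sub_one_ge` — `log 2 - h(α) ≥ 0.3157` on `[9/10, 1]`
  (`h` decreasing on `[1/2,1]`, `h(9/10) ≤ 1/10 + log 16/10`);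
* `spinRate_ge_fine` — `log 2 - h(1-y) ≥ log 2 + y log y - y` (`-(1-y) log(1-y) ≤ y`);
* `mul_log_sub_ge` — `v log v - v + 1 ≥ v/8` for `v ≥ 2`; `mul_log_sub_ge_neg_one` — `≥ 0`;
* `phi_lower_bound` — **AP (83) in the form used downstream**: for `k ≥ 1024` and
  `9/10 ≤ α ≤ 1`,
  `(log 2 - h(α)) ((2^k(k+1) - 3k - 1/2) - α k(2^k - 7/2)) ≥ 2^k log 2 + (k-1) log 2/2 - 1 - 10k²/2^k`.
-/

noncomputable section

namespace Literature.Computability.Complexity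

open Set Real Literature.Probability.LatticeModels

namespace RandomKSat

/-! ### The entropy factor -/

/-- `log 2 - h(α) = spinRate(2α - 1)` with Mathlib's binary entropy. [folklore] -/
theorem spinRate_two_mul_sub_one (α : ℝ) : spinRate (2 * α - 1) = Real.log 2 - Real.binEntropy α := by
  rw [spinRate_eq_log_two_sub_binEntropy]; congr 1; ring

/-- `h(9/10) ≤ 1/10 + (4 log 2)/10` (`log(10/9) ≤ 1/9`, `log 10 ≤ log 16 = 4 log 2`). [folklore] -/
theorem binEntropy_nine_tenths_le : Real.binEntropy (9 / 10) ≤ 1 / 10 + 4 * Real.log 2 / 10 := by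
  rw [Real.binEntropy_eq_negMulLog_add_negMulLog_one_sub, Real.negMulLog, Real.negMulLog]
  have h1 : Real.log (9 / 10 : ℝ) = -Real.log (10 / 9) := by
    rw [← Real.log_inv]; norm_num
  have h2 : Real.log ((10 : ℝ) / 9) ≤ 10 / 9 - 1 := Real.log_le_sub_one_of_pos (by norm_num)
  have h3 : (1 : ℝ) - 9 / 10 = 1 / 10 := by norm_num
  have h4 : Real.log ((1 : ℝ) / 10) = -Real.log 10 := by rw [one_div, Real.log_inv]
  have h5 : Real.log (10 : ℝ) ≤ Real.log 16 := Real.log_le_log (by norm_num) (by norm_num)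
  have h6 : Real.log (16 : ℝ) = 4 * Real.log 2 := by
    rw [show (16 : ℝ) = 2 ^ 4 by norm_num, Real.log_pow]; norm_num
  rw [h3, h1, h4]
  nlinarith [h2, h5, h6]

/-- On `[9/10, 1]`: `log 2 - h(α) ≥ 6/10 · log 2 - 1/10 (≥ 0.3157)`. [folklore] -/
theorem spinRate_two_mul_sub_one_ge {α : ℝ} (hα : 9 / 10 ≤ α) (hα1 : α ≤ 1) :
    6 / 10 * Real.log 2 - 1 / 10 ≤ spinRate (2 * α - 1) := by
  rw [spinRate_two_mul_sub_one]
  have hanti := Real.binEntropy_strictAntiOn.antitoneOn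
  have hmem9 : (9 / 10 : ℝ) ∈ Icc (2⁻¹ : ℝ) 1 := ⟨by norm_num, by norm_num⟩
  have hmemα : α ∈ Icc (2⁻¹ : ℝ) 1 := ⟨by norm_num at hα ⊢; linarith, hα1⟩
  have h := hanti hmem9 hmemα hα
  have h9 := binEntropy_nine_tenths_le
  linarith

/-- The fine lower bound `log 2 - h(1 - y) ≥ log 2 + y log y - y` for `0 ≤ y < 1`
(`-(1-y) log(1-y) ≤ y` from `log x ≥ 1 - 1/x`). [cite: AchlioptasPeres2004, eq. (39) p. 13] -/
theorem spinRate_ge_fine {y : ℝ} (hy1 : y < 1) :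
    Real.log 2 + y * Real.log y - y ≤ spinRate (2 * (1 - y) - 1) := by
  rw [spinRate_two_mul_sub_one, Real.binEntropy_eq_negMulLog_add_negMulLog_one_sub, Real.negMulLog,
    Real.negMulLog, show (1 : ℝ) - (1 - y) = y by ring]
  have hpos : 0 < 1 - y := by linarith
  have h := Real.one_sub_inv_le_log_of_pos hpos
  -- `(1-y) log(1-y) ≥ (1-y)(1 - 1/(1-y)) = -y`
  have h2 : -y ≤ (1 - y) * Real.log (1 - y) := by
    have := mul_le_mul_of_nonneg_left h hpos.le
    have e : (1 - y) * (1 - (1 - y)⁻¹) = -y := by field_simp; ring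
    linarith
  linarith

/-! ### `v log v - v + 1` -/

/-- `v log v - v + 1 ≥ 0` for `v ≥ 0` (equality at `v = 1`). [folklore] -/
theorem mul_log_sub_ge_neg_one {v : ℝ} (hv : 0 ≤ v) : 0 ≤ v * Real.log v - v + 1 := by
  rcases hv.eq_or_lt with rfl | hv0
  · simp
  · have h := Real.one_sub_inv_le_log_of_pos hv0
    have := mul_le_mul_of_nonneg_left h hv0.le
    have e : v * (1 - v⁻¹) = v - 1 := by field_simp
    linarith

/-- `v log v - v + 1 ≥ v/8` for `v ≥ 2` (the function `v log v - 9v/8 + 1` is increasing on `[2, ∞)`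
and positive at `2` since `log 2 > 0.69`). [folklore] -/
theorem mul_log_sub_ge {v : ℝ} (hv : 2 ≤ v) : v / 8 ≤ v * Real.log v - v + 1 := by
  set D : ℝ → ℝ := fun t => t * Real.log t - 9 * t / 8 + 1 with hD
  have hderiv : ∀ t, 0 < t → HasDerivAt D (Real.log t - 1 / 8) t := by
    intro t ht
    have h1 := Real.hasDerivAt_mul_log ht.ne'
    have h2 : HasDerivAt (fun t : ℝ => 9 * t / 8) (9 / 8) t := by
      have := ((hasDerivAt_id' t).const_mul 9).div_const 8
      refine this.congr_deriv ?_; ring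
    refine ((h1.fun_sub h2).add_const 1).congr_deriv ?_
    ring
  have hmono : MonotoneOn D (Ici 2) := by
    apply monotoneOn_of_deriv_nonneg (convex_Ici 2)
    · intro t ht
      exact (hderiv t (by linarith [mem_Ici.mp ht])).continuousAt.continuousWithinAt
    · rw [interior_Ici]; intro t ht
      exact (hderiv t (by linarith [mem_Ioi.mp ht])).differentiableAt.differentiableWithinAt
    · rw [interior_Ici]; intro t ht
      have ht2 : (2 : ℝ) < t := ht
      rw [(hderiv t (by linarith)).deriv]
      have hlog2 : (0.6931471803 : ℝ) < Real.log 2 := Real.log_two_gt_d9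
      have : Real.log 2 ≤ Real.log t := Real.log_le_log (by norm_num) ht2.le
      linarith
  have h2 : D 2 ≥ 0 := by
    simp only [hD]
    have hlog2 : (0.6931471803 : ℝ) < Real.log 2 := Real.log_two_gt_d9
    linarith
  have h := hmono (self_mem_Ici) (show v ∈ Ici (2 : ℝ) from hv) hv
  simp only [hD] at h h2
  linarith

/-! ### Numerical facts -/

/-- `log k ≤ 2 √k - 2` for `k > 0` (`log √k ≤ √k - 1`). [folklore] -/
theorem log_le_two_sqrt {x : ℝ} (hx : 0 < x) : Real.log x ≤ 2 * Real.sqrt x - 2 := by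
  have hs : 0 < Real.sqrt x := Real.sqrt_pos.mpr hx
  have h := Real.log_le_sub_one_of_pos hs
  have e : Real.log x = 2 * Real.log (Real.sqrt x) := by
    rw [Real.log_sqrt hx.le]; ring
  linarith

/-- `k³ ≤ 2^k` for `k ≥ 10`. [folklore] -/
theorem cube_le_two_pow {k : ℕ} (hk : 10 ≤ k) : (k : ℝ) ^ 3 ≤ 2 ^ k := by
  have h : ∀ n : ℕ, ((n + 10 : ℕ) : ℝ) ^ 3 ≤ 2 ^ (n + 10) := by
    intro n
    induction n with
    | zero => norm_num
    | succ n ih =>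
      have e : (2 : ℝ) ^ (n + 1 + 10) = 2 * 2 ^ (n + 10) := by ring
      rw [e]
      push_cast at ih ⊢
      have hn : (0 : ℝ) ≤ n := Nat.cast_nonneg n
      nlinarith [ih, pow_nonneg hn 3, pow_nonneg hn 2]
  obtain ⟨n, rfl⟩ : ∃ n, k = n + 10 := ⟨k - 10, by omega⟩
  exact h n

/-- `-(v log v) ≤ 1` for `v > 0` (`v log(1/v) ≤ 1 - v` for `v ≤ 1`, and `≤ 0` for `v ≥ 1`). [folklore] -/
theorem neg_mul_log_le_one {v : ℝ} (hv : 0 < v) : -(v * Real.log v) ≤ 1 := by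
  by_cases h1 : v ≤ 1
  · have h := Real.log_le_sub_one_of_pos (inv_pos.mpr hv)
    rw [Real.log_inv] at h
    have := mul_le_mul_of_nonneg_left h hv.le
    have e : v * (v⁻¹ - 1) = 1 - v := by field_simp
    nlinarith
  · push Not at h1
    have : 0 ≤ Real.log v := Real.log_nonneg h1.le
    nlinarith

/-- `16k ≤ 2^k` for `k ≥ 10` (from `k³ ≤ 2^k`). [folklore] -/
theorem sixteen_mul_le_two_pow' {k : ℕ} (hk : 10 ≤ k) : 16 * (k : ℝ) ≤ 2 ^ k := by
  have h := cube_le_two_pow hk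
  have hk' : (10 : ℝ) ≤ k := by exact_mod_cast hk
  have h1 : (16 : ℝ) ≤ k ^ 2 := by nlinarith
  have h2 : 16 * (k : ℝ) ≤ k ^ 2 * k := mul_le_mul_of_nonneg_right h1 (by linarith)
  calc 16 * (k : ℝ) ≤ k ^ 2 * k := h2
    _ = k ^ 3 := by ring
    _ ≤ 2 ^ k := h

/-! ### The remainder `R` in the three regimes of `v = y 2^k` -/

/-- Regime `v = y2^k ≤ 2`: the remainder is `≤ 10k²/2^k` (`k ≥ 25`). Here
`R = (y - y log y)((k-1)/2 + vk - (7/2)yk) + (7/2) y k log 2`. [cite: AchlioptasPeres2004, §9 pp. 19–21 (the regime `1 - α ≲ 2^{-k}`)] -/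
theorem remainder_le_small {k : ℕ} (hk : 25 ≤ k) {y : ℝ} (hy0 : 0 < y) (hv : y * 2 ^ k ≤ 2) :
    (y - y * Real.log y) * ((k - 1) / 2 + y * 2 ^ k * k - 7 / 2 * y * k) + 7 / 2 * y * k * Real.log 2 ≤
      10 * k ^ 2 / 2 ^ k := by
  have h2k : (0 : ℝ) < 2 ^ k := pow_pos two_pos k
  have hk' : (25 : ℝ) ≤ k := by exact_mod_cast hk
  have hl2 : Real.log 2 < 0.6931471808 := Real.log_two_lt_d9
  have hl2' : 0 < Real.log 2 := Real.log_pos one_lt_two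
  set v := y * 2 ^ k with hvdef
  have hv0 : 0 < v := by positivity
  have hyv : y = v / 2 ^ k := by rw [hvdef]; field_simp
  -- `-y log y = (v k log 2 - v log v)/2^k ≤ (2k log 2 + 1)/2^k`
  have hlogy : Real.log y = Real.log v - k * Real.log 2 := by
    rw [hvdef, Real.log_mul hy0.ne' h2k.ne', Real.log_pow]; ring
  have hnegA : y - y * Real.log y ≤ (7 / 5 * k + 3) / 2 ^ k := by
    rw [hlogy, hyv]
    have h1 := neg_mul_log_le_one hv0
    have e : v / 2 ^ k - v / 2 ^ k * (Real.log v - k * Real.log 2) =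
        (v + v * (k * Real.log 2) - v * Real.log v) / 2 ^ k := by field_simp; ring
    rw [e]
    apply div_le_div_of_nonneg_right _ h2k.le
    have h2 : v * (k * Real.log 2) ≤ 2 * (k * Real.log 2) :=
      mul_le_mul_of_nonneg_right hv (by positivity)
    nlinarith [h1, h2, hl2, hk']
  have hfac0 : 0 ≤ (k - 1) / 2 + y * 2 ^ k * k - 7 / 2 * y * k := by
    have : 7 / 2 * y * k ≤ 7 := by
      have : y * k ≤ 2 := by
        calc y * k ≤ y * 2 ^ k := mul_le_mul_of_nonneg_left (by linarith [sixteen_mul_le_two_pow' (by omega : 10 ≤ k)]) hy0.le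
          _ ≤ 2 := hv
      linarith
    have : (0 : ℝ) ≤ y * 2 ^ k * k := by positivity
    linarith
  have hfac : (k - 1) / 2 + y * 2 ^ k * k - 7 / 2 * y * k ≤ 5 / 2 * k := by
    have : y * 2 ^ k * k ≤ 2 * k := mul_le_mul_of_nonneg_right hv (by positivity)
    have : 0 ≤ 7 / 2 * y * k := by positivity
    linarith
  have hnegA0 : 0 ≤ y - y * Real.log y := by
    have hyle : y ≤ 1 := by
      have : y * 2 ^ k ≤ 2 := hv
      have : (2 : ℝ) ≤ 2 ^ k := by linarith [sixteen_mul_le_two_pow' (by omega : 10 ≤ k)]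
      nlinarith
    have : y * Real.log y ≤ 0 := mul_nonpos_of_nonneg_of_nonpos hy0.le (Real.log_nonpos hy0.le hyle)
    linarith
  have hyk : 7 / 2 * y * k * Real.log 2 ≤ 5 * k / 2 ^ k := by
    rw [hyv]
    rw [show 7 / 2 * (v / 2 ^ k) * k * Real.log 2 = (7 / 2 * v * Real.log 2) * k / 2 ^ k by ring]
    apply div_le_div_of_nonneg_right _ h2k.le
    have : 7 / 2 * v * Real.log 2 ≤ 5 := by nlinarith
    nlinarith
  calc (y - y * Real.log y) * ((k - 1) / 2 + y * 2 ^ k * k - 7 / 2 * y * k) + 7 / 2 * y * k * Real.log 2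
      ≤ (7 / 5 * k + 3) / 2 ^ k * (5 / 2 * k) + 5 * k / 2 ^ k := by
        have := mul_le_mul hnegA hfac hfac0 (by positivity)
        linarith
    _ = (7 / 2 * k ^ 2 + 25 / 2 * k) / 2 ^ k := by field_simp; ring
    _ ≤ 10 * k ^ 2 / 2 ^ k := by
        apply div_le_div_of_nonneg_right _ h2k.le
        nlinarith

/-- Middle regime `2 ≤ v ≤ 2^k/(12k²)`: `R ≤ (3/2) v²k²/2^k ≤ v/8 ≤ v log v - v + 1` (`k ≥ 5`).
[cite: AchlioptasPeres2004, §9 pp. 19–21] -/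
theorem remainder_le_middle {k : ℕ} (hk : 5 ≤ k) {y : ℝ} (hy0 : 0 < y) (hv2 : 2 ≤ y * 2 ^ k)
    (hvu : y * 2 ^ k * (12 * k ^ 2) ≤ 2 ^ k) :
    (y - y * Real.log y) * ((k - 1) / 2 + y * 2 ^ k * k - 7 / 2 * y * k) + 7 / 2 * y * k * Real.log 2 ≤
      y * 2 ^ k * Real.log (y * 2 ^ k) - y * 2 ^ k + 1 := by
  have h2k : (0 : ℝ) < 2 ^ k := pow_pos two_pos k
  have hk' : (5 : ℝ) ≤ k := by exact_mod_cast hk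
  have hl2 : Real.log 2 < 0.6931471808 := Real.log_two_lt_d9
  have hl2' : 0 < Real.log 2 := Real.log_pos one_lt_two
  set v := y * 2 ^ k with hvdef
  have hv0 : 0 < v := by positivity
  have hyv : y = v / 2 ^ k := by rw [hvdef]; field_simp
  have hlogy : Real.log y = Real.log v - k * Real.log 2 := by
    rw [hvdef, Real.log_mul hy0.ne' h2k.ne', Real.log_pow]; ring
  have hlogv : Real.log 2 ≤ Real.log v := Real.log_le_log (by norm_num) hv2
  -- `-a = y (1 + k log 2 - log v) ≤ y k`
  have hnegA : y - y * Real.log y ≤ y * k := by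
    rw [hlogy]
    have : 1 + k * Real.log 2 - Real.log v ≤ k := by nlinarith
    nlinarith
  have hnegA0 : 0 ≤ y - y * Real.log y := by
    rw [hlogy]
    -- `1 + k log 2 - log v ≥ 0` since `v ≤ 2^k`
    have hvle : v ≤ 2 ^ k := by
      have : (12 : ℝ) * k ^ 2 ≥ 1 := by nlinarith
      nlinarith
    have : Real.log v ≤ k * Real.log 2 := by
      rw [← Real.log_pow]; exact Real.log_le_log hv0 hvle
    nlinarith
  have hfac0 : 0 ≤ (k - 1) / 2 + v * k - 7 / 2 * y * k := by
    have : y ≤ 1 / 12 := by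
      rw [hyv, div_le_div_iff₀ h2k (by norm_num)]
      have : v * 12 ≤ v * (12 * k ^ 2) :=
        mul_le_mul_of_nonneg_left (by nlinarith) hv0.le
      linarith
    have : 0 ≤ v * k := by positivity
    nlinarith
  have hfac : (k - 1) / 2 + v * k - 7 / 2 * y * k ≤ k / 2 + v * k := by
    have : 0 ≤ 7 / 2 * y * k := by positivity
    linarith
  -- `R ≤ yk(k/2 + vk) + (7/2) yk log 2 ≤ (3/2) v² k²/2^k`
  have hR : (y - y * Real.log y) * ((k - 1) / 2 + v * k - 7 / 2 * y * k) + 7 / 2 * y * k * Real.log 2 ≤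
      3 / 2 * v ^ 2 * k ^ 2 / 2 ^ k := by
    have h1 := mul_le_mul hnegA hfac hfac0 (by positivity)
    have key : y * k * (k / 2 + v * k) + 7 / 2 * y * k * Real.log 2 ≤ 3 / 2 * v ^ 2 * k ^ 2 / 2 ^ k := by
      rw [hyv]
      have e : v / 2 ^ k * k * (k / 2 + v * k) + 7 / 2 * (v / 2 ^ k) * k * Real.log 2 =
          (v * k ^ 2 / 2 + v ^ 2 * k ^ 2 + 7 / 2 * (v * k) * Real.log 2) / 2 ^ k := by
        field_simp
      rw [e]
      apply div_le_div_of_nonneg_right _ h2k.le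
      have h7 : 7 * Real.log 2 ≤ k := by linarith
      have ha : 7 / 2 * (v * k) * Real.log 2 ≤ v * k ^ 2 / 2 := by
        have := mul_le_mul_of_nonneg_left h7 (by positivity : (0 : ℝ) ≤ v * k / 2)
        have e1 : v * k / 2 * (7 * Real.log 2) = 7 / 2 * (v * k) * Real.log 2 := by ring
        have e2 : v * k / 2 * k = v * k ^ 2 / 2 := by ring
        linarith [e1, e2]
      have hb : v * k ^ 2 ≤ v ^ 2 * k ^ 2 / 2 := by
        have := mul_le_mul_of_nonneg_right hv2 (by positivity : (0 : ℝ) ≤ v * k ^ 2)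
        have e1 : v * (v * k ^ 2) = v ^ 2 * k ^ 2 := by ring
        linarith [e1]
      linarith
    linarith [h1, key]
  -- `(3/2) v² k²/2^k ≤ v/8 ≤ v log v - v + 1`
  have hE := mul_log_sub_ge hv2
  have hmid : 3 / 2 * v ^ 2 * k ^ 2 / 2 ^ k ≤ v / 8 := by
    rw [div_le_div_iff₀ h2k (by norm_num)]
    nlinarith [hvu]
  linarith

set_option maxHeartbeats 400000 in
-- several explicit numerical estimates in one declaration
/-- Upper regime `v ≥ 2^k/(12k²)` (with `y ≤ 4/k`): `R ≤ v(4L + 1) ≤ v(k log 2 - L - 1) ≤ v log v - v`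
with `L = 1 + log 12 + 2 log k`, for `k ≥ 1024`. [cite: AchlioptasPeres2004, §9 pp. 19–21] -/
theorem remainder_le_large {k : ℕ} (hk : 1024 ≤ k) {y : ℝ} (hy0 : 0 < y) (hy : y ≤ 4 / k)
    (hvl : 2 ^ k ≤ y * 2 ^ k * (12 * k ^ 2)) :
    (y - y * Real.log y) * ((k - 1) / 2 + y * 2 ^ k * k - 7 / 2 * y * k) + 7 / 2 * y * k * Real.log 2 ≤
      y * 2 ^ k * Real.log (y * 2 ^ k) - y * 2 ^ k + 1 := by
  have h2k : (0 : ℝ) < 2 ^ k := pow_pos two_pos k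
  have hk' : (1024 : ℝ) ≤ k := by exact_mod_cast hk
  have hkpos : (0 : ℝ) < k := by linarith
  have hl2 : Real.log 2 < 0.6931471808 := Real.log_two_lt_d9
  have hl2l : 0.6931471803 < Real.log 2 := Real.log_two_gt_d9
  set v := y * 2 ^ k with hvdef
  have hv0 : 0 < v := by positivity
  have hyv : y = v / 2 ^ k := by rw [hvdef]; field_simp
  have hlogy : Real.log y = Real.log v - k * Real.log 2 := by
    rw [hvdef, Real.log_mul hy0.ne' h2k.ne', Real.log_pow]; ring
  -- `√k ≥ 32`, `log k ≤ 2√k - 2`, `log 12 ≤ 4 log 2`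
  have hsq : (32 : ℝ) ≤ Real.sqrt k := by
    rw [show (32 : ℝ) = Real.sqrt 1024 by
      rw [show (1024 : ℝ) = 32 ^ 2 by norm_num, Real.sqrt_sq (by norm_num)]]
    exact Real.sqrt_le_sqrt hk'
  have hsqk : Real.sqrt k * Real.sqrt k = k := Real.mul_self_sqrt hkpos.le
  have hlogk : Real.log k ≤ 2 * Real.sqrt k - 2 := log_le_two_sqrt hkpos
  have hlog12 : Real.log (12 : ℝ) ≤ 4 * Real.log 2 := by
    calc Real.log (12 : ℝ) ≤ Real.log 16 := Real.log_le_log (by norm_num) (by norm_num)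
      _ = 4 * Real.log 2 := by rw [show (16 : ℝ) = 2 ^ 4 by norm_num, Real.log_pow]; norm_num
  set L : ℝ := 1 + Real.log 12 + 2 * Real.log k with hL
  have hLle : L ≤ 4 * Real.sqrt k := by simp only [hL]; linarith
  have hL0 : 0 ≤ L := by
    simp only [hL]
    have : 0 ≤ Real.log (12 : ℝ) := Real.log_nonneg (by norm_num)
    have : 0 ≤ Real.log (k : ℝ) := Real.log_nonneg (by linarith)
    linarith
  -- `log v ≥ k log 2 - log 12 - 2 log k`
  have hlogv : k * Real.log 2 - Real.log 12 - 2 * Real.log k ≤ Real.log v := by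
    have hq : (2 : ℝ) ^ k / (12 * k ^ 2) ≤ v := by
      rw [div_le_iff₀ (by positivity)]; exact hvl
    have hqpos : 0 < (2 : ℝ) ^ k / (12 * k ^ 2) := by positivity
    have := Real.log_le_log hqpos hq
    rw [Real.log_div h2k.ne' (by positivity), Real.log_mul (by norm_num) (by positivity),
      Real.log_pow, Real.log_pow] at this
    push_cast at this
    linarith
  -- `-a = y (1 + k log 2 - log v) ≤ y L`
  have ea : y - y * Real.log y = y * (1 + k * Real.log 2 - Real.log v) := by rw [hlogy]; ring
  have hnegA : y - y * Real.log y ≤ y * L := by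
    rw [ea]
    apply mul_le_mul_of_nonneg_left _ hy0.le
    simp only [hL]; linarith
  have hnegA0 : 0 ≤ y - y * Real.log y := by
    rw [ea]
    apply mul_nonneg hy0.le
    have hvle : v ≤ 2 ^ k := by
      rw [hvdef]
      have : y ≤ 1 := by
        have : (4 : ℝ) / k ≤ 1 := by rw [div_le_one hkpos]; linarith
        linarith
      nlinarith
    have : Real.log v ≤ k * Real.log 2 := by
      rw [← Real.log_pow]; exact Real.log_le_log hv0 hvle
    linarith
  have hyk : y * k ≤ 4 := by
    have := mul_le_mul_of_nonneg_right hy hkpos.le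
    rwa [div_mul_cancel₀ _ hkpos.ne'] at this
  have hvk : 0 ≤ v * k := by positivity
  have hfac0 : 0 ≤ (k - 1) / 2 + v * k - 7 / 2 * y * k := by
    have e : 7 / 2 * y * k = 7 / 2 * (y * k) := by ring
    rw [e]; linarith
  have hfac : (k - 1) / 2 + v * k - 7 / 2 * y * k ≤ k / 2 + v * k := by
    have : 0 ≤ 7 / 2 * y * k := by positivity
    linarith
  -- `R ≤ yL(k/2 + vk) + (7/2) yk log 2 ≤ v(4L + 1)`
  have hk3 := cube_le_two_pow (by omega : 10 ≤ k)
  have hR : (y - y * Real.log y) * ((k - 1) / 2 + v * k - 7 / 2 * y * k) +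
      7 / 2 * y * k * Real.log 2 ≤ v * (4 * L + 1) := by
    have h1 := mul_le_mul hnegA hfac hfac0 (by positivity)
    have eyk : y * L * (k / 2 + v * k) = v * (L * (y * k)) + v * (L * k / (2 * 2 ^ k)) := by
      rw [hvdef]; field_simp; ring
    have hykL : v * (L * (y * k)) ≤ v * (4 * L) := by
      apply mul_le_mul_of_nonneg_left _ hv0.le
      nlinarith [mul_le_mul_of_nonneg_left hyk hL0]
    -- the small terms: `v · Lk/(2·2^k) + (7/2) y k log 2 ≤ v`
    have hsmall : v * (L * k / (2 * 2 ^ k)) + 7 / 2 * y * k * Real.log 2 ≤ v := by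
      rw [hyv]
      have e : v * (L * k / (2 * 2 ^ k)) + 7 / 2 * (v / 2 ^ k) * k * Real.log 2 =
          v * ((L * k / 2 + 7 / 2 * k * Real.log 2) / 2 ^ k) := by field_simp
      rw [e]
      have : (L * k / 2 + 7 / 2 * k * Real.log 2) / 2 ^ k ≤ 1 := by
        rw [div_le_one h2k]
        -- `L ≤ 4√k ≤ k/8` (as `√k ≥ 32`), so `Lk/2 + (7/2)k log 2 ≤ k²/16 + 3k ≤ k³ ≤ 2^k`
        have hsk : Real.sqrt k ≤ k / 32 := by
          rw [le_div_iff₀ (by norm_num)]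
          calc Real.sqrt k * 32 ≤ Real.sqrt k * Real.sqrt k := mul_le_mul_of_nonneg_left hsq (by positivity)
            _ = k := hsqk
        have hLk : L ≤ k / 8 := by linarith
        have h1' : L * k / 2 ≤ k / 8 * k / 2 := by
          apply div_le_div_of_nonneg_right _ (by norm_num)
          exact mul_le_mul_of_nonneg_right hLk hkpos.le
        have h2' : 7 / 2 * k * Real.log 2 ≤ 3 * k := by nlinarith
        have h3' : (k : ℝ) / 8 * k / 2 + 3 * k ≤ k ^ 3 := by nlinarith
        linarith
      calc v * ((L * k / 2 + 7 / 2 * k * Real.log 2) / 2 ^ k) ≤ v * 1 :=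
            mul_le_mul_of_nonneg_left this hv0.le
        _ = v := mul_one v
    calc (y - y * Real.log y) * ((k - 1) / 2 + v * k - 7 / 2 * y * k) + 7 / 2 * y * k * Real.log 2
        ≤ y * L * (k / 2 + v * k) + 7 / 2 * y * k * Real.log 2 := by linarith
      _ = v * (L * (y * k)) + (v * (L * k / (2 * 2 ^ k)) + 7 / 2 * y * k * Real.log 2) := by
          rw [eyk]; ring
      _ ≤ v * (4 * L) + v := add_le_add hykL hsmall
      _ = v * (4 * L + 1) := by ring
  -- `v(4L+1) ≤ v (k log 2 - L - 1) ≤ v log v - v ≤ v log v - v + 1`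
  have hcmp : 4 * L + 1 ≤ k * Real.log 2 - L - 1 := by
    have h5 : 5 * L + 2 ≤ 22 * Real.sqrt k := by linarith
    have h6 : 22 * Real.sqrt k ≤ k * Real.log 2 := by
      have h7 : 22 ≤ Real.sqrt k * Real.log 2 := by nlinarith
      calc 22 * Real.sqrt k ≤ (Real.sqrt k * Real.log 2) * Real.sqrt k :=
            mul_le_mul_of_nonneg_right h7 (by positivity)
        _ = k * Real.log 2 := by rw [mul_comm, ← mul_assoc, hsqk]
    linarith
  have hlow : v * (k * Real.log 2 - L - 1) ≤ v * Real.log v - v := by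
    have e : v * (k * Real.log 2 - L - 1) =
        v * (k * Real.log 2 - Real.log 12 - 2 * Real.log k) - 2 * v := by
      simp only [hL]; ring
    rw [e]
    linarith [mul_le_mul_of_nonneg_left hlogv hv0.le]
  have := mul_le_mul_of_nonneg_left hcmp hv0.le
  linarith

/-! ### Assembly -/

/-- The fine regime `0 < y = 1 - α ≤ 4/k` (`k ≥ 1024`):
`(log 2 + y log y - y)(2^k + (k-1)/2 + yk(2^k - 7/2)) ≥ 2^k log 2 + (k-1) log 2/2 - 1 - 10k²/2^k`
(the identity `= MAIN + (v log v - v) - R`, `v = y2^k`, and the three regimes of `v`).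
[cite: AchlioptasPeres2004, eq. (83) p. 21, direct form] -/
theorem phi_lower_fine {k : ℕ} (hk : 1024 ≤ k) {y : ℝ} (hy0 : 0 < y) (hy : y ≤ 4 / k) :
    2 ^ k * Real.log 2 + (k - 1) * Real.log 2 / 2 - 1 - 10 * k ^ 2 / 2 ^ k ≤
      (Real.log 2 + y * Real.log y - y) * (2 ^ k + (k - 1) / 2 + y * k * (2 ^ k - 7 / 2)) := by
  have h2k : (0 : ℝ) < 2 ^ k := pow_pos two_pos k
  have hτ : 0 ≤ 10 * (k : ℝ) ^ 2 / 2 ^ k := by positivity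
  -- the identity
  have hlogv : Real.log (y * 2 ^ k) = Real.log y + k * Real.log 2 := by
    rw [Real.log_mul hy0.ne' h2k.ne', Real.log_pow]
  have hid : (Real.log 2 + y * Real.log y - y) * (2 ^ k + (k - 1) / 2 + y * k * (2 ^ k - 7 / 2)) =
      (2 ^ k * Real.log 2 + (k - 1) * Real.log 2 / 2) +
        (y * 2 ^ k * Real.log (y * 2 ^ k) - y * 2 ^ k + 1) - 1 -
        ((y - y * Real.log y) * ((k - 1) / 2 + y * 2 ^ k * k - 7 / 2 * y * k) +
          7 / 2 * y * k * Real.log 2) := by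
    rw [hlogv]; ring
  rw [hid]
  have hE := mul_log_sub_ge_neg_one (v := y * 2 ^ k) (by positivity)
  -- the three regimes
  by_cases h1 : y * 2 ^ k ≤ 2
  · have hR := remainder_le_small (by omega) hy0 h1
    linarith
  · push Not at h1
    by_cases h2 : y * 2 ^ k * (12 * k ^ 2) ≤ 2 ^ k
    · have hR := remainder_le_middle (by omega) hy0 h1.le h2
      linarith
    · push Not at h2
      have hR := remainder_le_large hk hy0 hy h2.le
      linarith

/-- The coarse regime `9/10 ≤ α ≤ 1 - 4/k`: here `B - αC ≥ 5·2^k + k/2 - 29/2` and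
`log 2 - h(α) ≥ 0.3157`, so the product exceeds `2^k log 2 + (k-1) log 2/2` outright (`k ≥ 10`).
[cite: AchlioptasPeres2004, §9 p. 19 ("We are thus left to minimize φ in (9/10, 1]")] -/
theorem phi_lower_coarse {k : ℕ} (hk : 10 ≤ k) {α : ℝ} (hα : 9 / 10 ≤ α) (hαu : α ≤ 1 - 4 / k) :
    2 ^ k * Real.log 2 + (k - 1) * Real.log 2 / 2 - 1 - 10 * k ^ 2 / 2 ^ k ≤
      spinRate (2 * α - 1) * ((2 ^ k * (k + 1) - 3 * k - 1 / 2) - α * (k * (2 ^ k - 7 / 2))) := by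
  have h2k : (0 : ℝ) < 2 ^ k := pow_pos two_pos k
  have hk' : (10 : ℝ) ≤ k := by exact_mod_cast hk
  have hkpos : (0 : ℝ) < k := by linarith
  have h16 := sixteen_mul_le_two_pow' hk
  have hl2 : Real.log 2 < 0.6931471808 := Real.log_two_lt_d9
  have hl2l : 0.6931471803 < Real.log 2 := Real.log_two_gt_d9
  have hτ : 0 ≤ 10 * (k : ℝ) ^ 2 / 2 ^ k := by positivity
  have hα1 : α ≤ 1 := by
    have : 0 ≤ (4 : ℝ) / k := by positivity
    linarith
  have hS := spinRate_two_mul_sub_one_ge hα hα1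
  have hS0 : 0 ≤ 6 / 10 * Real.log 2 - 1 / 10 := by linarith
  -- `P ≥ 5·2^k + k/2 - 29/2 ≥ 0`
  have hαk : α * k ≤ k - 4 := by
    have := mul_le_mul_of_nonneg_right hαu hkpos.le
    rwa [sub_mul, one_mul, div_mul_cancel₀ _ hkpos.ne'] at this
  have hP : 5 * 2 ^ k + k / 2 - 29 / 2 ≤ (2 ^ k * (k + 1) - 3 * k - 1 / 2) - α * (k * (2 ^ k - 7 / 2)) := by
    have h27 : (0 : ℝ) ≤ 2 ^ k - 7 / 2 := by linarith
    have := mul_le_mul_of_nonneg_right hαk h27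
    nlinarith
  have hP0 : 0 ≤ 5 * (2 : ℝ) ^ k + k / 2 - 29 / 2 := by linarith
  have hprod := mul_le_mul hS hP hP0 (le_trans hS0 hS)
  -- `(0.6 log 2 - 0.1)(5·2^k + k/2 - 29/2) ≥ 2^k log 2 + (k-1) log 2/2`
  have hkey : 2 ^ k * Real.log 2 + (k - 1) * Real.log 2 / 2 ≤
      (6 / 10 * Real.log 2 - 1 / 10) * (5 * 2 ^ k + k / 2 - 29 / 2) := by
    nlinarith [mul_nonneg (sub_nonneg.2 hl2l.le) h2k.le, mul_nonneg (sub_nonneg.2 hl2l.le) hkpos.le,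
      mul_nonneg (sub_nonneg.2 hl2.le) h2k.le, mul_nonneg (sub_nonneg.2 hl2.le) hkpos.le]
  linarith

/-- **The minimum of `φ(α) = (log 2 - h(α))(B - αC)` on `[9/10, 1]`** (AP (68)–(83)): for
`k ≥ 1024` and `9/10 ≤ α ≤ 1`,
`spinRate(2α-1) · ((2^k(k+1) - 3k - 1/2) - α k (2^k - 7/2)) ≥ 2^k log 2 + (k-1) log 2/2 - 1 - 10k²/2^k`
(AP: `φ_min > 2^k log 2 + (k-1) log 2/2 - 1 - 46k³ 2^{-k}`, for `k ≥ 166`).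
[cite: AchlioptasPeres2004, eq. (83) p. 21] -/
theorem phi_lower_bound {k : ℕ} (hk : 1024 ≤ k) {α : ℝ} (hα : 9 / 10 ≤ α) (hα1 : α ≤ 1) :
    2 ^ k * Real.log 2 + (k - 1) * Real.log 2 / 2 - 1 - 10 * k ^ 2 / 2 ^ k ≤
      spinRate (2 * α - 1) * ((2 ^ k * (k + 1) - 3 * k - 1 / 2) - α * (k * (2 ^ k - 7 / 2))) := by
  have h2k : (0 : ℝ) < 2 ^ k := pow_pos two_pos k
  have hk' : (1024 : ℝ) ≤ k := by exact_mod_cast hk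
  have hkpos : (0 : ℝ) < k := by linarith
  have hτ : 0 ≤ 10 * (k : ℝ) ^ 2 / 2 ^ k := by positivity
  by_cases hcoarse : α ≤ 1 - 4 / k
  · exact phi_lower_coarse (by omega) hα hcoarse
  push Not at hcoarse
  -- the fine regime, `y = 1 - α < 4/k`
  set y : ℝ := 1 - α with hydef
  have hαy : α = 1 - y := by rw [hydef]; ring
  have hy0 : 0 ≤ y := by rw [hydef]; linarith
  have hy4 : y ≤ 4 / k := by rw [hydef]; linarith
  have hP : (2 ^ k * (k + 1) - 3 * k - 1 / 2) - α * (k * (2 ^ k - 7 / 2)) =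
      2 ^ k + (k - 1) / 2 + y * k * (2 ^ k - 7 / 2) := by rw [hαy]; ring
  have hP0 : 0 ≤ 2 ^ k + (k - 1) / 2 + y * k * (2 ^ k - 7 / 2) := by
    have : (0 : ℝ) ≤ 2 ^ k - 7 / 2 := by linarith [sixteen_mul_le_two_pow' (by omega : 10 ≤ k)]
    have : 0 ≤ y * k * (2 ^ k - 7 / 2) := by positivity
    linarith
  rw [hP, hαy]
  rcases hy0.eq_or_lt with hy00 | hy0'
  · -- `y = 0`, `α = 1`: the product is exactly the main term
    rw [← hy00]
    simp only [sub_zero, mul_one, zero_mul, add_zero]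
    rw [show (2 : ℝ) - 1 = 1 by norm_num, spinRate_one]
    nlinarith [Real.log_pos one_lt_two]
  · have hS := spinRate_ge_fine (y := y) (by
      have : (4 : ℝ) / k ≤ 1 / 2 := by rw [div_le_iff₀ hkpos]; linarith
      linarith)
    have hfine := phi_lower_fine hk hy0' hy4
    calc 2 ^ k * Real.log 2 + (k - 1) * Real.log 2 / 2 - 1 - 10 * k ^ 2 / 2 ^ k
        ≤ (Real.log 2 + y * Real.log y - y) * (2 ^ k + (k - 1) / 2 + y * k * (2 ^ k - 7 / 2)) := hfine
      _ ≤ spinRate (2 * (1 - y) - 1) * (2 ^ k + (k - 1) / 2 + y * k * (2 ^ k - 7 / 2)) :=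
          mul_le_mul_of_nonneg_right hS hP0

end RandomKSat

end Literature.Computability.Complexity

end
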